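import Summits.BirchSwinnertonDyer.BirchSwinnertonDyer.Theses.AdditiveKolyvaginRoad
import Literature.NumberTheory.EllipticCurves.SelmerTorsionRestriction

/-!
# LocGen — the one-prime localisation lemma for mod-`p` Kolyvagin classes (sketch, crux-ideate r1 seat 2 g42)

Crux: `KolyvaginPrimitiveAdditive` (KPA′, stmt-BirchSwinnertonDyer-21400). BSD is not proved by this file;
KPA′ is neither proved nor refuted. This file TYPES (sorry-free, definitions + two logic lemmas):

* `locTorsion` — `loc_v : H¹(K, E[m]) → H¹(K_v, E[m])` (torsion coefficients), the tree's `resTorsion`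
  at the completion `K_v = v.adicCompletion K`;
* `LocKolyvaginPrimitiveAdditive` (LocKPA′) — KPA′ with the conclusion strengthened to
  `loc_v c(n) ≠ 0` for some place `v ∣ p` of `K`;
* `LocGen` — the lemma of the note `LOGGEN-ONE-PRIME-NOTE.md`: on a ♯-type frame, if `c(n) ≠ 0` then for
  some Kolyvagin prime `ℓ ∤ n` (in fact a positive-density set) some datum at `n·ℓ` has `loc_v c(nℓ) ≠ 0`
  at a place `v ∣ p` — proved on paper by Poitou–Tate at ONE auxiliary prime (no core vertices, no
  Kolyvagin-system structure theory, no hypothesis on the reduction type at `p`);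
* `kpa_of_locKPA`, `locKPA_of_kpa` — LocKPA′ ⇒ KPA′ (trivial) and LocGen ⇒ (KPA′ ⇒ LocKPA′).

So, GIVEN LocGen, KPA′ ⟺ LocKPA′: Kolyvagin primitivity mod `p` at an additive prime is equivalent to a
purely 𝔭-LOCAL non-vanishing of one derived Heegner class — the form in which log-congruence transports
(Kriz–Li FMS 2019 Thm 1.16 / 3.9; cards `derived-coleman-log-covector`, `depleted-shadow-transfer`,
`bdp-rebase` on KS′) consume it. LocGen discharges the residual (G′) = LOGGEN = stub M∅-2 of
TRIAGE-r1-2 l.184.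
-/

namespace Summit.BirchSwinnertonDyer.BirchSwinnertonDyer.Cruxes.KolyvaginPrimitiveAdditive.LocGen

open Literature.NumberTheory.EllipticCurves IsDedekindDomain NumberField

/-- `loc_v : H¹(K, E[m]) → H¹(K_v, E[m])` for a finite place `v` of the number field `K`
(restriction to the decomposition group, torsion coefficients): the tree's `resTorsion` at the
`K`-algebra `K_v = v.adicCompletion K`. -/
noncomputable def locTorsion (W : WeierstrassCurve ℚ) (K : Type) [Field K] [NumberField K] (m : ℤ)
    (v : HeightOneSpectrum (𝓞 K)) :
    WeierstrassCurve.galH1Torsion (W.baseChange K) m →+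
      WeierstrassCurve.galH1Torsion ((W.baseChange K).baseChange (v.adicCompletion K)) m :=
  Literature.NumberTheory.EllipticCurves.resTorsion (W.baseChange K) (v.adicCompletion K) m

/-- **LocKPA′** — KPA′ (`KolyvaginPrimitiveAdditive`, binders verbatim) with the conclusion strengthened:
some Kolyvagin–Heegner datum of Kolyvagin-prime support `n` has `loc_v c(n) ≠ 0` in `H¹(K_v, E[p])` at
some place `v` of `K` above `p` (equivalently, by `τ`-equivariance, at both). -/
def LocKolyvaginPrimitiveAdditive : Prop :=
  ∀ (W : WeierstrassCurve ℚ) [W.IsElliptic] [W.IsGloballyMinimal] [NeZero (W.conductorNorm ℤ)] (p : ℕ)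
    [Fact p.Prime] (K : Type) [Field K] [NumberField K]
    (Dt : Literature.NumberTheory.EllipticCurves.ModularForms.ModularParametrizationData W (W.conductorNorm ℤ))
    (β : ℤ) (ι : K →+* ℂ), 5 ≤ p → Literature.NumberTheory.EllipticCurves.Rank1Residual.Addv W p →
    W.HasSurjectiveModNGaloisRep p →
    (∀ (ℓ : ℕ) [Fact ℓ.Prime], W.HasMultiplicativeReductionAtPrime ℓ →
      ¬ p ∣ padicValInt ℓ W.minimalDiscriminantInt) →
    (∃ (ℓ₁ ℓ₂ : ℕ) (_ : Fact ℓ₁.Prime) (_ : Fact ℓ₂.Prime), ℓ₁ ≠ ℓ₂ ∧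
      W.HasMultiplicativeReductionAtPrime ℓ₁ ∧ W.HasMultiplicativeReductionAtPrime ℓ₂) →
    ¬ p ∣ W.tamagawaProduct → W.analyticRank = 1 →
    Literature.NumberTheory.EllipticCurves.IsImaginaryQuadratic K → Odd (NumberField.discr K) →
    NumberField.discr K < -4 →
    Literature.NumberTheory.EllipticCurves.SatisfiesHeegnerHypothesis (W.conductorNorm ℤ) K →
    (W.quadraticTwist (NumberField.discr K : ℚ)).entireLFunction 1 ≠ 0 →
    (4 * (W.conductorNorm ℤ : ℤ)) ∣ β ^ 2 - NumberField.discr K → ¬ (p : ℤ) ∣ Dt.c →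
    ∃ (n : ℕ) (d : Literature.NumberTheory.EllipticCurves.KolyvaginHeegnerData Dt β ι n),
      Literature.NumberTheory.EllipticCurves.KolyvaginDescent.KolSupp
        (Literature.NumberTheory.EllipticCurves.Zhang2014.IsKolyvaginPrime (W.conductorNorm ℤ) W K p) n ∧
      ∃ v : HeightOneSpectrum (𝓞 K), ((p : ℕ) : 𝓞 K) ∈ v.asIdeal ∧
        locTorsion W K _ v (d.kolyvaginClass (Fact.out : p.Prime) 1) ≠ 0

/-- **LocGen** (one-prime localisation lemma, typed as a Prop; proof = note §2, Poitou–Tate at one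
auxiliary Kolyvagin prime). Standing hypotheses = the part of the ♯ frame the paper proof uses: `p ≥ 5`,
`E` additive at `p` (`Addv`, so `p² ∣ N`), `ρ̄_{E,p}` onto, `p ∤ ∏ c_ℓ`, `K` imaginary quadratic with
`d_K < -4` satisfying the Heegner hypothesis for `N` (hence `p` SPLIT in `K`), an orientation `β`. Conclusion: a non-zero class `c(n)` (Kolyvagin-prime support) propagates to a class
`c(n·ℓ)`, `ℓ ∤ n` a Kolyvagin prime, whose localisation at a place above `p` is non-zero. On paper the
set of such `ℓ` has positive density; only `∃ ℓ` is typed. -/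
def LocGen : Prop :=
  ∀ (W : WeierstrassCurve ℚ) [W.IsElliptic] [W.IsGloballyMinimal] [NeZero (W.conductorNorm ℤ)] (p : ℕ)
    [Fact p.Prime] (K : Type) [Field K] [NumberField K]
    (Dt : Literature.NumberTheory.EllipticCurves.ModularForms.ModularParametrizationData W (W.conductorNorm ℤ))
    (β : ℤ) (ι : K →+* ℂ), 5 ≤ p → Literature.NumberTheory.EllipticCurves.Rank1Residual.Addv W p →
    W.HasSurjectiveModNGaloisRep p → ¬ p ∣ W.tamagawaProduct →
    Literature.NumberTheory.EllipticCurves.IsImaginaryQuadratic K → NumberField.discr K < -4 →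
    Literature.NumberTheory.EllipticCurves.SatisfiesHeegnerHypothesis (W.conductorNorm ℤ) K →
    (4 * (W.conductorNorm ℤ : ℤ)) ∣ β ^ 2 - NumberField.discr K →
    ∀ (n : ℕ) (d : Literature.NumberTheory.EllipticCurves.KolyvaginHeegnerData Dt β ι n),
      Literature.NumberTheory.EllipticCurves.KolyvaginDescent.KolSupp
        (Literature.NumberTheory.EllipticCurves.Zhang2014.IsKolyvaginPrime (W.conductorNorm ℤ) W K p) n →
      d.kolyvaginClass (Fact.out : p.Prime) 1 ≠ 0 →
      ∃ ℓ : ℕ, Literature.NumberTheory.EllipticCurves.Zhang2014.IsKolyvaginPrime (W.conductorNorm ℤ) W K p ℓ ∧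
        ¬ ℓ ∣ n ∧
        Literature.NumberTheory.EllipticCurves.KolyvaginDescent.KolSupp
          (Literature.NumberTheory.EllipticCurves.Zhang2014.IsKolyvaginPrime (W.conductorNorm ℤ) W K p)
          (n * ℓ) ∧
        ∃ (d' : Literature.NumberTheory.EllipticCurves.KolyvaginHeegnerData Dt β ι (n * ℓ))
          (v : HeightOneSpectrum (𝓞 K)), ((p : ℕ) : 𝓞 K) ∈ v.asIdeal ∧
          locTorsion W K _ v (d'.kolyvaginClass (Fact.out : p.Prime) 1) ≠ 0

/-- LocKPA′ ⇒ KPA′: a class with a non-zero localisation is non-zero. -/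
theorem kpa_of_locKPA (h : LocKolyvaginPrimitiveAdditive) :
    Summit.BirchSwinnertonDyer.BirchSwinnertonDyer.Theses.AdditiveKolyvaginRoad.KolyvaginPrimitiveAdditive := by
  intro W _ _ _ p _ K _ _ Dt β ι h5 hadd hsurj hsp1 hsp2 htam hran hK hodd hdisc hheeg htw hβ hc
  obtain ⟨n, d, hsupp, v, -, hloc⟩ :=
    h W p K Dt β ι h5 hadd hsurj hsp1 hsp2 htam hran hK hodd hdisc hheeg htw hβ hc
  refine ⟨n, d, hsupp, fun h0 ↦ hloc ?_⟩
  rw [h0, map_zero]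

/-- LocGen ⇒ (KPA′ ⇒ LocKPA′): apply the one-prime lemma to the non-zero class KPA′ provides. -/
theorem locKPA_of_kpa (hL : LocGen)
    (h : Summit.BirchSwinnertonDyer.BirchSwinnertonDyer.Theses.AdditiveKolyvaginRoad.KolyvaginPrimitiveAdditive) :
    LocKolyvaginPrimitiveAdditive := by
  intro W _ _ _ p _ K _ _ Dt β ι h5 hadd hsurj hsp1 hsp2 htam hran hK hodd hdisc hheeg htw hβ hc
  obtain ⟨n, d, hsupp, hne⟩ :=
    h W p K Dt β ι h5 hadd hsurj hsp1 hsp2 htam hran hK hodd hdisc hheeg htw hβ hc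
  obtain ⟨ℓ, -, -, hsupp', d', v, hv, hloc⟩ := hL W p K Dt β ι h5 hadd hsurj htam hK hdisc hheeg hβ n d hsupp hne
  exact ⟨n * ℓ, d', hsupp', v, hv, hloc⟩

/-- Hence, given LocGen, KPA′ and LocKPA′ are equivalent. -/
theorem kpa_iff_locKPA (hL : LocGen) :
    Summit.BirchSwinnertonDyer.BirchSwinnertonDyer.Theses.AdditiveKolyvaginRoad.KolyvaginPrimitiveAdditive ↔
      LocKolyvaginPrimitiveAdditive :=
  ⟨locKPA_of_kpa hL, kpa_of_locKPA⟩

end Summit.BirchSwinnertonDyer.BirchSwinnertonDyer.Cruxes.KolyvaginPrimitiveAdditive.LocGen
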